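import Mathlib

/-!
# Route «KPlusLogSqLaw», crux `WeakLifting` (stmt-ValiantsHypothesis-19561) — α row, RESOLVED limit:
# the TOWARD LEMMA for alternating edge words (kernel core of THEOREM A, g17)

HONEST FRAMING.  Helper lemma (`--supports stmt-ValiantsHypothesis-19561 --as helper`), seat pub-symmetroid-conjb-2 (g17), cell `pub-symmetroid`,
2026-08-28.  Elementary exchange argument for maximum-weight matchings of a path with edge weights affine in a parameter; nothing here is a
root count, and nothing bears on `WeakLifting` / `TropicalB` in their windows, on Conjecture B (`KPlusLogSqLaw`), on `MatrixDescartes` or on VP ≠ VNP.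

CONTEXT (paper: cell deposit HOME/pub-symmetroid-conjb-2/g17/theory/THEORY-NOTE-g17.md §1, §4.7).  For a definite tridiagonal monomial design the
edge polynomial is `F(x) = Σ_μ (−1)^{|μ|} Π_{k∈μ} α_k x^{λ_k}` over the matchings `μ` of the path; in the resolved limit `α_k = e^{h a_k}`, `h → ∞`,
its zero set is governed by the upper envelope `E(t) = max_μ W(μ, t)`, `W(μ, t) = Σ_{k∈μ} a_k + t Σ_{k∈μ} λ_k` (parametric max-plus matching), one
LAYER of zeros per breakpoint.  THEOREM A of the note: if the signs of `λ` ALTERNATE along the path then at every breakpoint the optimal matching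
changes only by positive-slope edges ENTERING and negative-slope edges LEAVING («toward» flips); hence every edge changes membership at most once
along the envelope and there are at most `m − 1` layers (the tight class of the resolved door-(A) census).  This file is the exchange lemma behind
it, in invariant form and WITHOUT definitions (matchings are finsets `μ ⊆ range N` of pairwise non-consecutive edges, optimality is spelled out):
if `μ` is optimal at two times `t₁ < t₂` and `μ'` is optimal at `t₂`, then `μ' \ μ` consists of positive-slope edges and `μ \ μ'` of negative-slope
edges (`toward_of_alternating`); consequently positive edges persist and negative non-edges persist (`persist_of_alternating`).  PROOF: the «away»
part `A` of `μ ∆ μ'` is closed under path-adjacency inside `μ ∆ μ'` (membership and sign both alternate), so swapping it gives matchings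
`ν = (μ \ A) ∪ (μ' ∩ A)`, `ν' = (μ' \ A) ∪ (μ ∩ A)` with `W ν + W ν' = W μ + W μ'`; optimality at `t₂` forces `W ν t₂ = W μ t₂`, and if `A ≠ ∅`
the slope of `ν` is smaller than that of `μ`, so `ν` beats `μ` at `t₁` — contradiction.  [this seat; elementary]
-/

-- `Summit.ValiantsHypothesis.ValiantsHypothesis.…` repeats a component by the D-0017 layout (single-conjunct summit); the name is mandated.
set_option linter.dupNamespace false

namespace Summit.ValiantsHypothesis.ValiantsHypothesis.Theorems.KPlusLogSqLaw.ResolvedAlternating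

open Finset

/-! ## 1. Finset bookkeeping for the swap (weights `Σ_{k∈μ} a_k + t Σ_{k∈μ} λ_k`) -/

/-- splitting a sum along `A`: `Σ_μ = Σ_{μ \ A} + Σ_{μ ∩ A}`. -/
theorem sum_split (f : ℕ → ℝ) (μ A : Finset ℕ) :
    ∑ k ∈ μ, f k = ∑ k ∈ μ \ A, f k + ∑ k ∈ μ ∩ A, f k := by
  have hd : Disjoint (μ \ A) (μ ∩ A) := disjoint_sdiff_inter μ A
  conv_lhs => rw [← sdiff_union_inter μ A]
  rw [sum_union hd]

/-- `μ \ A` and `μ' ∩ A` are disjoint. -/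
theorem disjoint_sdiff_inter' (μ μ' A : Finset ℕ) : Disjoint (μ \ A) (μ' ∩ A) := by
  rw [Finset.disjoint_left]
  intro i hi hi'
  exact (mem_sdiff.1 hi).2 (mem_inter.1 hi').2

/-- the swap identity: `Σ_{(μ \ A) ∪ (μ' ∩ A)} f + Σ_{(μ' \ A) ∪ (μ ∩ A)} f = Σ_μ f + Σ_{μ'} f`. -/
theorem sum_swap (f : ℕ → ℝ) (μ μ' A : Finset ℕ) :
    ∑ k ∈ μ \ A ∪ μ' ∩ A, f k + ∑ k ∈ μ' \ A ∪ μ ∩ A, f k = ∑ k ∈ μ, f k + ∑ k ∈ μ', f k := by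
  rw [sum_union (disjoint_sdiff_inter' μ μ' A), sum_union (disjoint_sdiff_inter' μ' μ A), sum_split f μ A, sum_split f μ' A]
  ring

/-! ## 2. The toward lemma -/

/-- THE TOWARD LEMMA (THEOREM A (i) of THEORY-NOTE-g17 §4.7).  Edges `0, …, N − 1` of a path (edge `i` joins vertices `i`, `i+1`), slopes `λ`
with ALTERNATING signs and nonzero, intercepts `a`; matchings = finsets of pairwise non-consecutive edges; `μ` maximises the weight
`Σ_{k∈μ} a_k + t Σ_{k∈μ} λ_k` at `t = t₁` and at `t = t₂ > t₁`, `μ'` maximises it at `t₂`.  Then every edge of `μ' \ μ` has positive slope and every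
edge of `μ \ μ'` has negative slope. -/
theorem toward_of_alternating (N : ℕ) (a lam : ℕ → ℝ)
    (halt : ∀ i, i + 1 < N → lam i * lam (i + 1) < 0) (hnz : ∀ i, i < N → lam i ≠ 0)
    (t₁ t₂ : ℝ) (ht : t₁ < t₂) (μ μ' : Finset ℕ)
    (hμN : μ ⊆ range N) (hμm : ∀ i ∈ μ, i + 1 ∉ μ) (hμ'N : μ' ⊆ range N) (hμ'm : ∀ i ∈ μ', i + 1 ∉ μ')
    (hopt₁ : ∀ ν : Finset ℕ, ν ⊆ range N → (∀ i ∈ ν, i + 1 ∉ ν) →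
      ∑ k ∈ ν, a k + t₁ * ∑ k ∈ ν, lam k ≤ ∑ k ∈ μ, a k + t₁ * ∑ k ∈ μ, lam k)
    (hopt₂ : ∀ ν : Finset ℕ, ν ⊆ range N → (∀ i ∈ ν, i + 1 ∉ ν) →
      ∑ k ∈ ν, a k + t₂ * ∑ k ∈ ν, lam k ≤ ∑ k ∈ μ, a k + t₂ * ∑ k ∈ μ, lam k)
    (hopt₂' : ∀ ν : Finset ℕ, ν ⊆ range N → (∀ i ∈ ν, i + 1 ∉ ν) →
      ∑ k ∈ ν, a k + t₂ * ∑ k ∈ ν, lam k ≤ ∑ k ∈ μ', a k + t₂ * ∑ k ∈ μ', lam k) :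
    (∀ e ∈ μ' \ μ, 0 < lam e) ∧ (∀ e ∈ μ \ μ', lam e < 0) := by
  classical
  -- the away set
  set A : Finset ℕ := ((μ' \ μ).filter fun i => lam i < 0) ∪ ((μ \ μ').filter fun i => 0 < lam i) with hA
  have hAμ' : ∀ i ∈ A, i ∈ μ' → i ∉ μ ∧ lam i < 0 := by
    intro i hi hiμ'
    rcases mem_union.1 hi with h | h
    · obtain ⟨h1, h2⟩ := mem_filter.1 h
      exact ⟨(mem_sdiff.1 h1).2, h2⟩
    · obtain ⟨h1, _⟩ := mem_filter.1 h
      exact absurd hiμ' (mem_sdiff.1 h1).2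
  have hAμ : ∀ i ∈ A, i ∈ μ → i ∉ μ' ∧ 0 < lam i := by
    intro i hi hiμ
    rcases mem_union.1 hi with h | h
    · obtain ⟨h1, _⟩ := mem_filter.1 h
      exact absurd hiμ (mem_sdiff.1 h1).2
    · obtain ⟨h1, h2⟩ := mem_filter.1 h
      exact ⟨(mem_sdiff.1 h1).2, h2⟩
  have hAD : ∀ i ∈ A, (i ∈ μ' ∧ i ∉ μ ∧ lam i < 0) ∨ (i ∈ μ ∧ i ∉ μ' ∧ 0 < lam i) := by
    intro i hi
    rcases mem_union.1 hi with h | h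
    · obtain ⟨h1, h2⟩ := mem_filter.1 h
      exact Or.inl ⟨(mem_sdiff.1 h1).1, (mem_sdiff.1 h1).2, h2⟩
    · obtain ⟨h1, h2⟩ := mem_filter.1 h
      exact Or.inr ⟨(mem_sdiff.1 h1).1, (mem_sdiff.1 h1).2, h2⟩
  have memA : ∀ i, ((i ∈ μ' ∧ i ∉ μ ∧ lam i < 0) ∨ (i ∈ μ ∧ i ∉ μ' ∧ 0 < lam i)) → i ∈ A := by
    intro i h
    rcases h with ⟨h1, h2, h3⟩ | ⟨h1, h2, h3⟩
    · exact mem_union.2 (Or.inl (mem_filter.2 ⟨mem_sdiff.2 ⟨h1, h2⟩, h3⟩))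
    · exact mem_union.2 (Or.inr (mem_filter.2 ⟨mem_sdiff.2 ⟨h1, h2⟩, h3⟩))
  -- alternation of signs, in usable form
  have sign_succ : ∀ i, i + 1 < N → (0 < lam i ↔ lam (i + 1) < 0) := by
    intro i hi
    have h := halt i hi
    constructor
    · intro hp
      by_contra hq
      have hq' : 0 ≤ lam (i + 1) := not_lt.1 hq
      have : 0 ≤ lam i * lam (i + 1) := mul_nonneg hp.le hq'
      linarith
    · intro hq
      by_contra hp
      have hp' : lam i ≤ 0 := not_lt.1 hp
      have : 0 ≤ lam i * lam (i + 1) := mul_nonneg_of_nonpos_of_nonpos hp' hq.le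
      linarith
  -- KEY: the away set is closed under adjacency inside the symmetric difference `μ ∆ μ'`.
  have closed_up : ∀ i, i ∈ A → (i + 1 ∈ μ ∨ i + 1 ∈ μ') → ¬ (i + 1 ∈ μ ∧ i + 1 ∈ μ') → i + 1 ∈ A := by
    intro i hi hD _
    have hi1N : i + 1 < N := by
      rcases hD with h | h
      · exact mem_range.1 (hμN h)
      · exact mem_range.1 (hμ'N h)
    have hs := sign_succ i hi1N
    have hnz1 := hnz (i + 1) hi1N
    rcases hAD i hi with ⟨hiμ', _, hneg⟩ | ⟨hiμ, _, hpos⟩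
    · have h1 : i + 1 ∉ μ' := hμ'm i hiμ'
      have h2 : i + 1 ∈ μ := by
        rcases hD with h | h
        · exact h
        · exact absurd h h1
      have h3 : 0 < lam (i + 1) := by
        rcases lt_or_gt_of_ne hnz1 with h | h
        · exact absurd (hs.2 h) (by linarith)
        · exact h
      exact memA _ (Or.inr ⟨h2, h1, h3⟩)
    · have h1 : i + 1 ∉ μ := hμm i hiμ
      have h2 : i + 1 ∈ μ' := by
        rcases hD with h | h
        · exact absurd h h1
        · exact h
      exact memA _ (Or.inl ⟨h2, h1, hs.1 hpos⟩)
  have closed_down : ∀ i, i + 1 ∈ A → (i ∈ μ ∨ i ∈ μ') → ¬ (i ∈ μ ∧ i ∈ μ') → i ∈ A := by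
    intro i hi hD _
    have hi1N : i + 1 < N := by
      rcases hAD (i + 1) hi with ⟨h, _, _⟩ | ⟨h, _, _⟩
      · exact mem_range.1 (hμ'N h)
      · exact mem_range.1 (hμN h)
    have hs := sign_succ i hi1N
    have hnz0 := hnz i (by omega)
    rcases hAD (i + 1) hi with ⟨hiμ', _, hneg⟩ | ⟨hiμ, _, hpos⟩
    · have h1 : i ∉ μ' := fun h => hμ'm i h hiμ'
      have h2 : i ∈ μ := by
        rcases hD with h | h
        · exact h
        · exact absurd h h1
      exact memA _ (Or.inr ⟨h2, h1, hs.2 hneg⟩)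
    · have h1 : i ∉ μ := fun h => hμm i h hiμ
      have h2 : i ∈ μ' := by
        rcases hD with h | h
        · exact absurd h h1
        · exact h
      have h3 : lam i < 0 := by
        rcases lt_or_gt_of_ne hnz0 with h | h
        · exact h
        · exact absurd (hs.1 h) (by linarith)
      exact memA _ (Or.inl ⟨h2, h1, h3⟩)
  -- the swapped matchings
  set ν : Finset ℕ := (μ \ A) ∪ (μ' ∩ A) with hν
  set ν' : Finset ℕ := (μ' \ A) ∪ (μ ∩ A) with hν'
  have hνN : ν ⊆ range N := by
    intro i hi
    rcases mem_union.1 hi with h | h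
    · exact hμN (mem_sdiff.1 h).1
    · exact hμ'N (mem_inter.1 h).1
  have hνm : ∀ i ∈ ν, i + 1 ∉ ν := by
    intro i hi hi1
    rcases mem_union.1 hi with h | h <;> rcases mem_union.1 hi1 with h' | h'
    · exact hμm i (mem_sdiff.1 h).1 (mem_sdiff.1 h').1
    · obtain ⟨hiμ, hiA⟩ := mem_sdiff.1 h
      obtain ⟨hi1μ', hi1A⟩ := mem_inter.1 h'
      by_cases hiμ' : i ∈ μ'
      · exact hμ'm i hiμ' hi1μ'
      · exact hiA (closed_down i hi1A (Or.inl hiμ) (fun hh => hiμ' hh.2))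
    · obtain ⟨hiμ', hiA⟩ := mem_inter.1 h
      obtain ⟨hi1μ, hi1A⟩ := mem_sdiff.1 h'
      by_cases hi1μ' : i + 1 ∈ μ'
      · exact hμ'm i hiμ' hi1μ'
      · exact hi1A (closed_up i hiA (Or.inl hi1μ) (fun hh => hi1μ' hh.2))
    · exact hμ'm i (mem_inter.1 h).1 (mem_inter.1 h').1
  have hν'N : ν' ⊆ range N := by
    intro i hi
    rcases mem_union.1 hi with h | h
    · exact hμ'N (mem_sdiff.1 h).1
    · exact hμN (mem_inter.1 h).1
  have hν'm : ∀ i ∈ ν', i + 1 ∉ ν' := by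
    intro i hi hi1
    rcases mem_union.1 hi with h | h <;> rcases mem_union.1 hi1 with h' | h'
    · exact hμ'm i (mem_sdiff.1 h).1 (mem_sdiff.1 h').1
    · obtain ⟨hiμ', hiA⟩ := mem_sdiff.1 h
      obtain ⟨hi1μ, hi1A⟩ := mem_inter.1 h'
      by_cases hiμ : i ∈ μ
      · exact hμm i hiμ hi1μ
      · exact hiA (closed_down i hi1A (Or.inr hiμ') (fun hh => hiμ hh.1))
    · obtain ⟨hiμ, hiA⟩ := mem_inter.1 h
      obtain ⟨hi1μ', hi1A⟩ := mem_sdiff.1 h'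
      by_cases hi1μ : i + 1 ∈ μ
      · exact hμm i hiμ hi1μ
      · exact hi1A (closed_up i hiA (Or.inr hi1μ') (fun hh => hi1μ hh.1))
    · exact hμm i (mem_inter.1 h).1 (mem_inter.1 h').1
  -- weights and slopes of the swap
  have hsa : ∑ k ∈ ν, a k + ∑ k ∈ ν', a k = ∑ k ∈ μ, a k + ∑ k ∈ μ', a k := by
    rw [hν, hν']; exact sum_swap a μ μ' A
  have hsl : ∑ k ∈ ν, lam k + ∑ k ∈ ν', lam k = ∑ k ∈ μ, lam k + ∑ k ∈ μ', lam k := by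
    rw [hν, hν']; exact sum_swap lam μ μ' A
  have hWν : ∑ k ∈ ν, a k + t₂ * ∑ k ∈ ν, lam k = ∑ k ∈ μ, a k + t₂ * ∑ k ∈ μ, lam k := by
    have h1 := hopt₂ ν hνN hνm
    have h2 := hopt₂' ν' hν'N hν'm
    have h3 : (∑ k ∈ ν, a k + t₂ * ∑ k ∈ ν, lam k) + (∑ k ∈ ν', a k + t₂ * ∑ k ∈ ν', lam k)
        = (∑ k ∈ μ, a k + t₂ * ∑ k ∈ μ, lam k) + (∑ k ∈ μ', a k + t₂ * ∑ k ∈ μ', lam k) := by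
      have := congrArg (fun x => t₂ * x) hsl
      simp only [mul_add] at this
      linarith
    linarith
  have hslope : ∑ k ∈ ν, lam k = ∑ k ∈ μ, lam k - ∑ k ∈ μ ∩ A, lam k + ∑ k ∈ μ' ∩ A, lam k := by
    rw [hν, sum_union (disjoint_sdiff_inter' μ μ' A), sum_split lam μ A]
    ring
  by_cases hAne : A.Nonempty
  · -- an away flip exists: the swap has strictly smaller slope and beats `μ` at `t₁`
    exfalso
    have hstrict : ∑ k ∈ ν, lam k < ∑ k ∈ μ, lam k := by
      have hnonpos : ∑ k ∈ μ' ∩ A, lam k ≤ 0 :=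
        sum_nonpos fun j hj => (hAμ' j (mem_inter.1 hj).2 (mem_inter.1 hj).1).2.le
      have hnonneg : 0 ≤ ∑ k ∈ μ ∩ A, lam k :=
        sum_nonneg fun j hj => (hAμ j (mem_inter.1 hj).2 (mem_inter.1 hj).1).2.le
      obtain ⟨i, hi⟩ := hAne
      rcases hAD i hi with ⟨hiμ', _, _⟩ | ⟨hiμ, _, _⟩
      · have : ∑ k ∈ μ' ∩ A, lam k < 0 :=
          sum_neg (fun j hj => (hAμ' j (mem_inter.1 hj).2 (mem_inter.1 hj).1).2) ⟨i, mem_inter.2 ⟨hiμ', hi⟩⟩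
        linarith
      · have : 0 < ∑ k ∈ μ ∩ A, lam k :=
          sum_pos (fun j hj => (hAμ j (mem_inter.1 hj).2 (mem_inter.1 hj).1).2) ⟨i, mem_inter.2 ⟨hiμ, hi⟩⟩
        linarith
    have hW₁ := hopt₁ ν hνN hνm
    have hlt : (t₁ - t₂) * ∑ k ∈ μ, lam k < (t₁ - t₂) * ∑ k ∈ ν, lam k :=
      mul_lt_mul_of_neg_left hstrict (by linarith)
    -- W ν t₁ = W ν t₂ + (t₁ - t₂) slope ν  >  W μ t₂ + (t₁ - t₂) slope μ = W μ t₁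
    nlinarith [hWν, hW₁, hlt]
  · -- no away flip: every flip is toward
    rw [not_nonempty_iff_eq_empty] at hAne
    constructor
    · intro e he
      obtain ⟨heμ', heμ⟩ := mem_sdiff.1 he
      rcases lt_or_gt_of_ne (hnz e (mem_range.1 (hμ'N heμ'))) with h | h
      · have : e ∈ A := memA e (Or.inl ⟨heμ', heμ, h⟩)
        rw [hAne] at this
        exact absurd this (Finset.notMem_empty e)
      · exact h
    · intro e he
      obtain ⟨heμ, heμ'⟩ := mem_sdiff.1 he
      rcases lt_or_gt_of_ne (hnz e (mem_range.1 (hμN heμ))) with h | h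
      · exact h
      · have : e ∈ A := memA e (Or.inr ⟨heμ, heμ', h⟩)
        rw [hAne] at this
        exact absurd this (Finset.notMem_empty e)

/-- MONOTONICITY (THEOREM A (ii), invariant form): along the envelope of an alternating word a positive-slope edge, once in an optimal matching,
lies in every matching optimal at a later time, and a negative-slope non-edge stays outside — so every edge changes membership at most once and
an alternating word with `m − 1` edges has at most `m − 1` breakpoints. -/
theorem persist_of_alternating (N : ℕ) (a lam : ℕ → ℝ)
    (halt : ∀ i, i + 1 < N → lam i * lam (i + 1) < 0) (hnz : ∀ i, i < N → lam i ≠ 0)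
    (t₁ t₂ : ℝ) (ht : t₁ < t₂) (μ μ' : Finset ℕ)
    (hμN : μ ⊆ range N) (hμm : ∀ i ∈ μ, i + 1 ∉ μ) (hμ'N : μ' ⊆ range N) (hμ'm : ∀ i ∈ μ', i + 1 ∉ μ')
    (hopt₁ : ∀ ν : Finset ℕ, ν ⊆ range N → (∀ i ∈ ν, i + 1 ∉ ν) →
      ∑ k ∈ ν, a k + t₁ * ∑ k ∈ ν, lam k ≤ ∑ k ∈ μ, a k + t₁ * ∑ k ∈ μ, lam k)
    (hopt₂ : ∀ ν : Finset ℕ, ν ⊆ range N → (∀ i ∈ ν, i + 1 ∉ ν) →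
      ∑ k ∈ ν, a k + t₂ * ∑ k ∈ ν, lam k ≤ ∑ k ∈ μ, a k + t₂ * ∑ k ∈ μ, lam k)
    (hopt₂' : ∀ ν : Finset ℕ, ν ⊆ range N → (∀ i ∈ ν, i + 1 ∉ ν) →
      ∑ k ∈ ν, a k + t₂ * ∑ k ∈ ν, lam k ≤ ∑ k ∈ μ', a k + t₂ * ∑ k ∈ μ', lam k) :
    (∀ e ∈ μ, 0 < lam e → e ∈ μ') ∧ (∀ e ∉ μ, lam e < 0 → e ∉ μ') := by
  obtain ⟨hin, hout⟩ :=
    toward_of_alternating N a lam halt hnz t₁ t₂ ht μ μ' hμN hμm hμ'N hμ'm hopt₁ hopt₂ hopt₂'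
  constructor
  · intro e he hpos
    by_contra hne
    have := hout e (Finset.mem_sdiff.2 ⟨he, hne⟩)
    linarith
  · intro e he hneg heμ'
    have := hin e (Finset.mem_sdiff.2 ⟨heμ', he⟩)
    linarith

end Summit.ValiantsHypothesis.ValiantsHypothesis.Theorems.KPlusLogSqLaw.ResolvedAlternating
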